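import Summits.RiemannHypothesis.RiemannHypothesis.Theorems.ScrewSquaringLawDyadicLandauMellin
import Mathlib.Topology.MetricSpace.Thickening
import HarnessLib

/-!
# Landau abscissa of the doubling defect (stub `stub_landauAbscissa` of crux
`ScrewSquaringLaw.DyadicLandau`, stmt-RiemannHypothesis-23894)

Route `ScrewSquaringLaw` (L45), line «DoublingChain», registered stub (L).  `Ψ = zetaScrew`
(Suzuki 2023, arXiv:2206.03682, (1.1)).  If `Ψ(2t) ≤ 4Ψ(t) + K` on `[0, ∞)`, the doubling defect
`g(x) = 4Ψ(log x) − Ψ(2 log x) + K` is non-negative on `(1, ∞)`; its Mellin integrand converges absolutely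
at `σ = 2` and its transform there is `Φ(s) = 4R(s) − ½R(s/2) + K/s`, `R(s) = s⁻²(ξ'/ξ)(½+s)`
(`Theorems/ScrewSquaringLawDyadicLandauMellin.lean`).  `Φ` is holomorphic on `{Re s > 2}` and near every
point of the real ray `(0, ∞)` (`ξ` has no real zeros: `riemannXi_half_add_ofReal_ne_zero` at `σ` and
`σ/2`), so on a thin open rectangle around any compact real segment `[ε/2, 4]`
(`IsCompact.exists_thickening_subset_open`).  Landau's lemma (Montgomery–Vaughan Lemma 15.1, tree
`Landau.integrableOn_of_differentiableOn_union_convex`) pushes the abscissa of absolute convergence of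
`g` below every `ε > 0`: `(4Ψ(t) − Ψ(2t) + K) e^{-σt} ∈ L¹(0, ∞)` for every `σ > 0`.  The proof is the
template `ZetaScrewLandau.riemannXi_ne_zero_of_zetaScrew_nonneg` (ZetaScrewThm17Proofs) with `Φ` in
place of `R`.

A DETECTION statement about `ζ`'s own screw function; RH is not proved here and nothing here bears on
the truth of RH.
-/

-- `Summit.RiemannHypothesis.RiemannHypothesis.…` repeats a component by the tree's layout (D-0017).
set_option linter.dupNamespace false

noncomputable section

open Complex Filter Topology Set MeasureTheory

namespace Summit.RiemannHypothesis.RiemannHypothesis.Theorems.ScrewSquaringLaw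

open Literature.NumberTheory.LFunctions Literature.NumberTheory.LFunctions.ZetaScrewLandau

/-- `½R(s/2)`'s kernel `s ↦ (s/2)⁻² (ξ'/ξ)(½ + s/2)` is differentiable at every `s ≠ 0` with
`ξ(½ + s/2) ≠ 0`. -/
theorem differentiableAt_R_half {s : ℂ} (hs0 : s ≠ 0) (hξ : riemannXi (1 / 2 + s / 2) ≠ 0) :
    DifferentiableAt ℂ (fun s : ℂ ↦ 1 / (s / 2) ^ 2 * logDeriv riemannXi (1 / 2 + s / 2)) s := by
  have hs2 : s / 2 ≠ 0 := div_ne_zero hs0 two_ne_zero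
  have h := differentiableAt_R hs2 hξ
  have h2 : DifferentiableAt ℂ (fun s : ℂ ↦ s / 2) s := differentiableAt_id.div_const 2
  exact h.comp s h2

/-- The two zero-free conditions `ξ(½+s) ≠ 0`, `ξ(½+s/2) ≠ 0` define an open set. -/
theorem isOpen_xi_ne_zero_and_half :
    IsOpen ({s : ℂ | riemannXi (1 / 2 + s) ≠ 0} ∩ {s : ℂ | riemannXi (1 / 2 + s / 2) ≠ 0}) := by
  have h1 : IsOpen {s : ℂ | riemannXi (1 / 2 + s) ≠ 0} := by
    have : {s : ℂ | riemannXi (1 / 2 + s) ≠ 0} = (fun s : ℂ ↦ riemannXi (1 / 2 + s)) ⁻¹' {0}ᶜ := rfl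
    rw [this]
    exact isOpen_compl_singleton.preimage (differentiable_riemannXi.continuous.comp (by fun_prop))
  have h2 : IsOpen {s : ℂ | riemannXi (1 / 2 + s / 2) ≠ 0} := by
    have : {s : ℂ | riemannXi (1 / 2 + s / 2) ≠ 0} =
        (fun s : ℂ ↦ riemannXi (1 / 2 + s / 2)) ⁻¹' {0}ᶜ := rfl
    rw [this]
    exact isOpen_compl_singleton.preimage (differentiable_riemannXi.continuous.comp (by fun_prop))
  exact h1.inter h2

/-- Real points are zero-free for both conditions: `ξ(½+σ) ≠ 0` and `ξ(½+σ/2) ≠ 0`. -/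
theorem ofReal_mem_xi_ne_zero_and_half (σ : ℝ) :
    (σ : ℂ) ∈ ({s : ℂ | riemannXi (1 / 2 + s) ≠ 0} ∩ {s : ℂ | riemannXi (1 / 2 + s / 2) ≠ 0}) := by
  refine ⟨riemannXi_half_add_ofReal_ne_zero σ, ?_⟩
  have : (1 / 2 : ℂ) + (σ : ℂ) / 2 = 1 / 2 + ((σ / 2 : ℝ) : ℂ) := by push_cast; ring
  show riemannXi (1 / 2 + (σ : ℂ) / 2) ≠ 0
  rw [this]
  exact riemannXi_half_add_ofReal_ne_zero (σ / 2)

/-- **Stub `stub_landauAbscissa` (crux `ScrewSquaringLaw.DyadicLandau`): the Landau abscissa of the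
doubling defect.** If `Ψ(2t) ≤ 4Ψ(t) + K` for all `t ≥ 0`, then `(4Ψ(t) − Ψ(2t) + K) e^{-σt}` is integrable
on `(0, ∞)` for every `σ > 0` (Landau's lemma for the non-negative function `4Ψ(log x) − Ψ(2 log x) + K`,
whose transform `4R(s) − ½R(s/2) + K/s` is holomorphic near the whole real ray `(0, ∞)`). -/
theorem stub_landauAbscissa :
    ∀ K : ℝ, (∀ t : ℝ, 0 ≤ t → zetaScrew (2 * t) ≤ 4 * zetaScrew t + K) →
      ∀ σ : ℝ, 0 < σ →
        IntegrableOn (fun t : ℝ ↦ (4 * zetaScrew t - zetaScrew (2 * t) + K) * Real.exp (-σ * t))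
          (Ioi 0) := by
  intro K hK σ hσ
  rw [← integrableOn_doublingDefect_iff]
  -- an auxiliary abscissa `0 < ε < min σ 1`
  set ε : ℝ := min (σ / 2) (1 / 2) with hε_def
  have hε0 : 0 < ε := lt_min (by positivity) (by norm_num)
  have hεσ : ε < σ := lt_of_le_of_lt (min_le_left _ _) (by linarith)
  have hε2 : ε < 2 := lt_of_le_of_lt (min_le_right _ _) (by norm_num)
  set g : ℝ → ℝ := fun x ↦ 4 * zetaScrew (Real.log x) - zetaScrew (2 * Real.log x) + K with hg_def
  have hg : Measurable g := measurable_doublingDefectLog K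
  -- a thin rectangle around the real segment `[ε/2, 4]`, free of zeros of `ξ(½+s)` and `ξ(½+s/2)`
  set Kc : Set ℂ := (fun σ' : ℝ ↦ (σ' : ℂ)) '' Icc (ε / 2) 4 with hKc_def
  have hKcc : IsCompact Kc := isCompact_Icc.image Complex.continuous_ofReal
  set U : Set ℂ := {s : ℂ | riemannXi (1 / 2 + s) ≠ 0} ∩ {s : ℂ | riemannXi (1 / 2 + s / 2) ≠ 0}
    with hU_def
  have hUo : IsOpen U := isOpen_xi_ne_zero_and_half
  have hKU : Kc ⊆ U := by
    rintro _ ⟨σ', _, rfl⟩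
    exact ofReal_mem_xi_ne_zero_and_half σ'
  obtain ⟨d₀, hd₀, hthick⟩ := hKcc.exists_thickening_subset_open hUo hKU
  set W₀ : Set ℂ := {s : ℂ | ε / 2 < s.re ∧ s.re < 4 ∧ -d₀ < s.im ∧ s.im < d₀} with hW₀_def
  have hW₀eq : W₀ = {s : ℂ | ε / 2 < s.re} ∩ ({s : ℂ | s.re < 4} ∩ ({s : ℂ | -d₀ < s.im} ∩
      {s : ℂ | s.im < d₀})) := by
    ext s; simp [hW₀_def]
  have hW₀o : IsOpen W₀ := by
    rw [hW₀eq]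
    exact (isOpen_lt continuous_const Complex.continuous_re).inter
      ((isOpen_lt Complex.continuous_re continuous_const).inter
        ((isOpen_lt continuous_const Complex.continuous_im).inter
          (isOpen_lt Complex.continuous_im continuous_const)))
  have hW₀c : Convex ℝ W₀ := by
    rw [hW₀eq]
    exact (convex_halfSpace_re_gt _).inter ((convex_halfSpace_re_lt _).inter
      ((convex_halfSpace_im_gt _).inter (convex_halfSpace_im_lt _)))
  have hW₀U : W₀ ⊆ U := by
    intro s hs
    refine hthick (Metric.mem_thickening_iff.2 ⟨(s.re : ℂ), ⟨s.re, ⟨hs.1.le, hs.2.1.le⟩, rfl⟩, ?_⟩)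
    rw [dist_eq_norm]
    have : s - (s.re : ℂ) = (s.im : ℂ) * I := by
      apply Complex.ext <;> simp
    rw [this, norm_mul, Complex.norm_I, mul_one, Complex.norm_real, Real.norm_eq_abs, abs_lt]
    exact ⟨hs.2.2.1, hs.2.2.2⟩
  have hW₀r : ∀ σ' : ℝ, ε < σ' → σ' ≤ 2 + 1 → (σ' : ℂ) ∈ W₀ := by
    intro σ' h1 h2
    simp only [hW₀_def, Set.mem_setOf_eq, ofReal_re, ofReal_im, neg_lt_zero]
    exact ⟨by linarith, by linarith, hd₀, hd₀⟩
  -- `Φ = 4R(s) − ½R(s/2) + K/s` is holomorphic on `{Re s > 2} ∪ W₀`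
  set Φ : ℂ → ℂ := fun s ↦ 4 * (1 / s ^ 2 * logDeriv riemannXi (1 / 2 + s)) -
      1 / 2 * (1 / (s / 2) ^ 2 * logDeriv riemannXi (1 / 2 + s / 2)) + K / s with hΦ_def
  have hΦ : DifferentiableOn ℂ Φ ({s : ℂ | 2 < s.re} ∪ W₀) := by
    intro s hs
    have hsre : ε / 2 < s.re := by
      rcases hs with hs | hs
      · simp only [Set.mem_setOf_eq] at hs; linarith
      · exact hs.1
    have hs0 : s ≠ 0 := fun h0 ↦ by rw [h0, zero_re] at hsre; linarith
    have hU : s ∈ U := by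
      rcases hs with hs | hs
      · simp only [Set.mem_setOf_eq] at hs
        refine ⟨riemannXi_ne_zero_of_one_le_re ?_, riemannXi_ne_zero_of_one_le_re ?_⟩
        · simp; linarith
        · simp; linarith
      · exact hW₀U hs
    have h1 := differentiableAt_R hs0 hU.1
    have h2 := differentiableAt_R_half hs0 hU.2
    have h3 : DifferentiableAt ℂ (fun s : ℂ ↦ (K : ℂ) / s) s :=
      (differentiableAt_const _).div differentiableAt_id hs0
    exact (((h1.const_mul (4 : ℂ)).sub (h2.const_mul (1 / 2 : ℂ))).add h3).differentiableWithinAt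
  -- and agrees with the transform of `g` on `Re s > 2`
  have hagree : EqOn Φ (Landau.mellinIoi g) {s : ℂ | 2 < s.re} := by
    intro s hs
    simp only [Set.mem_setOf_eq] at hs
    exact (mellinIoi_doublingDefectLog K hs).symm
  have hint : IntegrableOn (fun x ↦ g x * x ^ (-((2 : ℝ) + 1))) (Ioi 1) :=
    integrableOn_doublingDefectLog_two K
  have hpos : ∀ x : ℝ, 1 < x → 0 ≤ g x := by
    intro x hx
    have := hK (Real.log x) (Real.log_pos hx).le
    simp only [hg_def]
    linarith
  -- Landau's lemma
  exact Landau.integrableOn_of_differentiableOn_union_convex hg hint le_rfl hpos hε2 hW₀o hW₀c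
    hW₀r hΦ hagree hεσ

end Summit.RiemannHypothesis.RiemannHypothesis.Theorems.ScrewSquaringLaw

end
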